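import Mathlib
import HarnessLib
import Summits.NavierStokesRegularity.NavierStokesRegularity.Theorems.PoloidalWindowDoorPoloidalWindowRigiditySparseEnergyPowerWeights

/-!
# Route `PoloidalWindowDoor`, crux `PoloidalWindowRigidity` (stmt-19708), line `sparse_energy` (cstrat g11) —
# stub S1 `stub_scaledEnergy`, near-apex bootstrap: the SCALED WINDOW INTEGRAL `R^{2b−2}·J(b)` as a power of `x = R²/(−t₀)`

Seat ns-poloidal-K2-p2 g9 (successor of the interim LEAD-of-record on 19708; file `--supports`).  `…SparseEnergyEnvRound.envelope_round` bounds the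
cut-off energy at `t₀ ∈ (−R², 0)` by `(A+B)R + Σ_b c_b·J(b)`, `J(b) = ((R²)^{1−b} − (−t₀)^{1−b})/(1−b)`, where each `c_b` carries the power `R^{2b−1}`
(`c_γ ∝ R^{2γ−1}`, `c_{γ+½} ∝ R^{2γ}`, `c_{3γ/2} ∝ R^{3γ−1}`).  To read the result as the NEXT ENVELOPE `K'·R·x^{γ'}` (`x = R²/(−t₀) ≥ 1` on the near
regime) one needs, for `b ≠ 1`:

* `scaledJ_le_of_lt_one` — `b < 1`: `R^{2b−2}·J(b) ≤ 1/(1−b)`;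
* `scaledJ_le_of_one_lt` — `b > 1`: `R^{2b−2}·J(b) ≤ x^{b−1}/(b−1)`, `x = R²/(−t₀)`;
* `scaledJ_le` — both cases at once: `R^{2b−2}·J(b) ≤ x^e/|1−b|` for any `e ≥ max(b−1,0)`;
* `round_rhs_le_envelope` — the right-hand side of `envelope_round` (coefficients `a₁ R^{2γ−1}`, `a₂ R^{2γ}`, `a₃ R^{3γ−1}` abstracted) is
  `≤ (A + B + a₁/|1−γ| + a₂/|½−γ| + a₃/|1−3γ/2|)·R·x^{γ'}` for every `γ' ≥ max(γ−1,0), max(γ−½,0), max(3γ/2−1,0)` — i.e. the round's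
  output IS the next envelope `IH(γ', K')`.

WHAT THIS IS NOT: not a claim about Navier–Stokes — real algebra (bears_on LADDER-NS N0 via crux 19708, line sparse_energy, stub S1). [folklore]
-/

noncomputable section

-- the summit and its single sub-problem share the name (CONVENTIONS §1), as in every Theorems file
set_option linter.dupNamespace false

namespace Summit.NavierStokesRegularity.NavierStokesRegularity.Theorems.PoloidalWindowDoorPoloidalWindowRigiditySparseEnergyRoundStep

/-- `(R²)^{1−b} = R² · R^{−2b} · …`: precisely `R^(2b−2) · (R²)^(1−b) = 1` for `R > 0`. [folklore] -/
theorem rpow_scale_cancel {R b : ℝ} (hR : 0 < R) : R ^ (2 * b - 2) * (R ^ 2) ^ (1 - b) = 1 := by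
  rw [show (R ^ 2 : ℝ) = R ^ (2 : ℝ) from (Real.rpow_two R).symm, ← Real.rpow_mul hR.le, ← Real.rpow_add hR]
  rw [show 2 * b - 2 + 2 * (1 - b) = (0 : ℝ) by ring, Real.rpow_zero]

/-- **`b < 1`: `R^{2b−2} · ((R²)^{1−b} − (−t₀)^{1−b})/(1−b) ≤ 1/(1−b)`** (`R > 0`, `t₀ < 0`). [folklore] -/
theorem scaledJ_le_of_lt_one {R t₀ b : ℝ} (hR : 0 < R) (ht₀ : t₀ < 0) (hb : b < 1) :
    R ^ (2 * b - 2) * (((R ^ 2) ^ (1 - b) - (-t₀) ^ (1 - b)) / (1 - b)) ≤ 1 / (1 - b) := by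
  have h1b : 0 < 1 - b := sub_pos.2 hb
  have hpos : 0 ≤ R ^ (2 * b - 2) * (-t₀) ^ (1 - b) := mul_nonneg (Real.rpow_nonneg hR.le _) (Real.rpow_nonneg (neg_pos.2 ht₀).le _)
  rw [mul_div_assoc', div_le_div_iff_of_pos_right h1b, mul_sub, rpow_scale_cancel hR]
  linarith

/-- **`b > 1`: `R^{2b−2} · ((R²)^{1−b} − (−t₀)^{1−b})/(1−b) ≤ (R²/(−t₀))^{b−1}/(b−1)`** (`R > 0`, `t₀ < 0`). [folklore] -/
theorem scaledJ_le_of_one_lt {R t₀ b : ℝ} (hR : 0 < R) (ht₀ : t₀ < 0) (hb : 1 < b) :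
    R ^ (2 * b - 2) * (((R ^ 2) ^ (1 - b) - (-t₀) ^ (1 - b)) / (1 - b)) ≤ (R ^ 2 / (-t₀)) ^ (b - 1) / (b - 1) := by
  have hb1 : 0 < b - 1 := sub_pos.2 hb
  have hτ : 0 < -t₀ := neg_pos.2 ht₀
  have hx : R ^ (2 * b - 2) * (-t₀) ^ (1 - b) = (R ^ 2 / (-t₀)) ^ (b - 1) := by
    rw [Real.div_rpow (sq_nonneg R) hτ.le, show (R ^ 2 : ℝ) ^ (b - 1) = R ^ (2 * b - 2) by
      rw [show (R ^ 2 : ℝ) = R ^ (2 : ℝ) from (Real.rpow_two R).symm, ← Real.rpow_mul hR.le]; ring_nf,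
      show (1 - b) = -(b - 1) by ring, Real.rpow_neg hτ.le, div_eq_mul_inv]
  have e : R ^ (2 * b - 2) * (((R ^ 2) ^ (1 - b) - (-t₀) ^ (1 - b)) / (1 - b)) =
      ((R ^ 2 / (-t₀)) ^ (b - 1) - 1) / (b - 1) := by
    rw [mul_div_assoc', mul_sub, rpow_scale_cancel hR, hx, show (1 - b) = -(b - 1) by ring, div_neg, ← neg_div, neg_sub]
  rw [e, div_le_div_iff_of_pos_right hb1]
  linarith

/-- **Both cases under one exponent.**  For `b ≠ 1`, `R > 0`, `t₀ < 0` with `x = R²/(−t₀) ≥ 1` and any `e ≥ max(b−1, 0)`: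
`R^{2b−2}·J(b) ≤ x^e/|1−b|`. [folklore] -/
theorem scaledJ_le {R t₀ b e : ℝ} (hR : 0 < R) (ht₀ : t₀ < 0) (hx : 1 ≤ R ^ 2 / (-t₀)) (hb : b ≠ 1) (he : max (b - 1) 0 ≤ e) :
    R ^ (2 * b - 2) * (((R ^ 2) ^ (1 - b) - (-t₀) ^ (1 - b)) / (1 - b)) ≤ (R ^ 2 / (-t₀)) ^ e / |1 - b| := by
  have he0 : 0 ≤ e := le_trans (le_max_right _ _) he
  have hxe : 1 ≤ (R ^ 2 / (-t₀)) ^ e := Real.one_le_rpow hx he0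
  rcases lt_or_gt_of_ne hb with hb1 | hb1
  · rw [abs_of_pos (sub_pos.2 hb1)]
    exact (scaledJ_le_of_lt_one hR ht₀ hb1).trans (div_le_div_of_nonneg_right hxe (sub_pos.2 hb1).le)
  · rw [abs_of_neg (sub_neg.2 hb1), neg_sub]
    refine (scaledJ_le_of_one_lt hR ht₀ hb1).trans (div_le_div_of_nonneg_right ?_ (sub_pos.2 hb1).le)
    exact Real.rpow_le_rpow_of_exponent_le hx (le_trans (le_max_left _ _) he)

/-- **The round, read as the next envelope.**  With `x = R²/(−t₀) ≥ 1` (near regime `−R² ≤ t₀ < 0`), nonnegative coefficients and any exponent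
`γ' ≥ max(γ−1,0), max(γ−½,0), max(3γ/2−1,0)` (`γ ∉ {1, ½, ⅔}`), the right-hand side of `…SparseEnergyEnvRound.envelope_round` is at most
`(A + B + a₁/|1−γ| + a₂/|½−γ| + a₃/|1−3γ/2|)·R·x^{γ'}`. [folklore] -/
theorem round_rhs_le_envelope {A B a₁ a₂ a₃ R t₀ γ γ' : ℝ} (hA : 0 ≤ A) (hB : 0 ≤ B) (ha₁ : 0 ≤ a₁) (ha₂ : 0 ≤ a₂) (ha₃ : 0 ≤ a₃)
    (hR : 0 < R) (ht₀ : t₀ < 0) (hx : 1 ≤ R ^ 2 / (-t₀)) (hγ1 : γ ≠ 1) (hγ2 : γ ≠ 1 / 2) (hγ3 : γ ≠ 2 / 3)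
    (he₁ : max (γ - 1) 0 ≤ γ') (he₂ : max (γ + 1 / 2 - 1) 0 ≤ γ') (he₃ : max (3 * γ / 2 - 1) 0 ≤ γ') :
    A * R ^ 2 / Real.sqrt (R ^ 2) + B * R ^ 3 / R ^ 2 +
        (a₁ * R ^ (2 * γ - 1) * (((R ^ 2) ^ (1 - γ) - (-t₀) ^ (1 - γ)) / (1 - γ)) +
          a₂ * R ^ (2 * γ) * (((R ^ 2) ^ (1 - (γ + 1 / 2)) - (-t₀) ^ (1 - (γ + 1 / 2))) / (1 - (γ + 1 / 2))) +
          a₃ * R ^ (3 * γ - 1) * (((R ^ 2) ^ (1 - 3 * γ / 2) - (-t₀) ^ (1 - 3 * γ / 2)) / (1 - 3 * γ / 2))) ≤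
      (A + B + a₁ / |1 - γ| + a₂ / |1 - (γ + 1 / 2)| + a₃ / |1 - 3 * γ / 2|) * R * (R ^ 2 / (-t₀)) ^ γ' := by
  set x : ℝ := R ^ 2 / (-t₀) with hxdef
  have hγ' : 0 ≤ γ' := le_trans (le_max_right _ _) he₁
  have hx1 : 1 ≤ x ^ γ' := Real.one_le_rpow hx hγ'
  have hb₂ : γ + 1 / 2 ≠ 1 := fun h => hγ2 (by linarith)
  have hb₃ : 3 * γ / 2 ≠ 1 := fun h => hγ3 (by linarith)
  -- the three scaled window integrals
  have h₁ := scaledJ_le hR ht₀ hx hγ1 he₁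
  have h₂ := scaledJ_le hR ht₀ hx hb₂ he₂
  have h₃ := scaledJ_le hR ht₀ hx hb₃ he₃
  -- split off one power of `R`
  have eR : ∀ s : ℝ, R ^ s = R * R ^ (s - 1) := fun s => by
    conv_lhs => rw [show s = 1 + (s - 1) by ring, Real.rpow_add hR, Real.rpow_one]
  have e₁ : R ^ (2 * γ - 1) = R * R ^ (2 * γ - 2) := by rw [eR]; ring_nf
  have e₂ : R ^ (2 * γ) = R * R ^ (2 * (γ + 1 / 2) - 2) := by rw [eR]; ring_nf
  have e₃ : R ^ (3 * γ - 1) = R * R ^ (2 * (3 * γ / 2) - 2) := by rw [eR]; ring_nf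
  have t₁ : a₁ * R ^ (2 * γ - 1) * (((R ^ 2) ^ (1 - γ) - (-t₀) ^ (1 - γ)) / (1 - γ)) ≤ a₁ * (R * (x ^ γ' / |1 - γ|)) := by
    rw [e₁, mul_assoc, mul_assoc]
    exact mul_le_mul_of_nonneg_left (mul_le_mul_of_nonneg_left h₁ hR.le) ha₁
  have t₂ : a₂ * R ^ (2 * γ) * (((R ^ 2) ^ (1 - (γ + 1 / 2)) - (-t₀) ^ (1 - (γ + 1 / 2))) / (1 - (γ + 1 / 2))) ≤
      a₂ * (R * (x ^ γ' / |1 - (γ + 1 / 2)|)) := by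
    rw [e₂, mul_assoc, mul_assoc]
    exact mul_le_mul_of_nonneg_left (mul_le_mul_of_nonneg_left h₂ hR.le) ha₂
  have t₃ : a₃ * R ^ (3 * γ - 1) * (((R ^ 2) ^ (1 - 3 * γ / 2) - (-t₀) ^ (1 - 3 * γ / 2)) / (1 - 3 * γ / 2)) ≤
      a₃ * (R * (x ^ γ' / |1 - 3 * γ / 2|)) := by
    rw [e₃, mul_assoc, mul_assoc]
    exact mul_le_mul_of_nonneg_left (mul_le_mul_of_nonneg_left h₃ hR.le) ha₃
  -- the two `R`-linear terms
  have eA : A * R ^ 2 / Real.sqrt (R ^ 2) = A * R := by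
    rw [Real.sqrt_sq hR.le, pow_two, ← mul_assoc, mul_div_assoc, div_self hR.ne', mul_one]
  have eB : B * R ^ 3 / R ^ 2 = B * R := by
    rw [mul_div_assoc, show R ^ 3 / R ^ 2 = R by field_simp]
  have tA : A * R ≤ A * R * x ^ γ' := le_mul_of_one_le_right (mul_nonneg hA hR.le) hx1
  have tB : B * R ≤ B * R * x ^ γ' := le_mul_of_one_le_right (mul_nonneg hB hR.le) hx1
  rw [eA, eB]
  have expand : (A + B + a₁ / |1 - γ| + a₂ / |1 - (γ + 1 / 2)| + a₃ / |1 - 3 * γ / 2|) * R * x ^ γ' =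
      A * R * x ^ γ' + B * R * x ^ γ' + a₁ * (R * (x ^ γ' / |1 - γ|)) + a₂ * (R * (x ^ γ' / |1 - (γ + 1 / 2)|)) +
        a₃ * (R * (x ^ γ' / |1 - 3 * γ / 2|)) := by ring
  rw [expand]
  linarith

end Summit.NavierStokesRegularity.NavierStokesRegularity.Theorems.PoloidalWindowDoorPoloidalWindowRigiditySparseEnergyRoundStep

end
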